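import Summits.BirchSwinnertonDyer.BirchSwinnertonDyer.Theorems.GenusKolyvaginAtTwoEquivariantChebotarevAtTwoStepB
import Literature.NumberTheory.EllipticCurves.HeegnerPointsKolyvaginPrimaryCebotarevProofs
import Literature.NumberTheory.EllipticCurves.HeegnerPointsKolyvaginPrimaryCongruenceProofs
import Literature.NumberTheory.EllipticCurves.IsogenyFrobeniusTraceProofs
import Literature.NumberTheory.EllipticCurves.HeegnerPointsOfConductor

/-!
# Route `GenusKolyvaginAtTwo`, LINE 6, Q5 `EquivariantChebotarevAtTwo`: McCallum's Cor. 3.2 at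
# `p = 2` for a `τ`-STABLE family, from the Čebotarev density theorem
# (helper, PROVED modulo the named fact `Automorphic.chebotarev_artinRep`; seat gk2-p2 g5)

The tree proves McCallum 1991 Cor. 3.2 at level `p^M`, `p` odd, from Čebotarev
(`exists_kolyvaginPrime_gt_pow`, `HeegnerPointsKolyvaginPrimaryCebotarevProofs`). This file is
that proof LINE BY LINE with `p := 2` and its three `p`-odd steps replaced:
* the image data on `E_p` («every square of an automorphism is realised», shears are squares for
  `p` odd — `KolyvaginImage.*`) ↦ the hypotheses `hS`, `hCe`: `E[2]` is a simple `Γ_K`-module with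
  scalar commutant (true iff `ρ̄_{E,2}(Γ_K) = GL₂(𝔽₂)`, i.e. `ρ̄_{E,2}` onto and `K ≠ ℚ(√Δ_E)` —
  a binder Q5 does NOT carry; on `K = ℚ(√Δ_E)` the image is `A₃` with commutant `𝔽₄`);
* the `±`-eigenvectors of complex conjugation on `E[p^M]` ↦ a point `P₀ ∈ E(ℚ̄)[2^M]` with
  `a P₀ + b c₀P₀ = 0 ⟹ 2^M ∣ a, b` (`hfree₀`: Q1 `CyclicTorsionOfNegDisc` — proved, item 24879 —
  together with `#E[2^M] = 4^M`; this is where `Δ(E) < 0` enters);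
* Step B (`IsLiftOfAut.exists_h1Eval_conj_mul_order`, eigenclasses, `2 ∈ (ℤ/p^M)^×`) ↦
  `exists_h1Eval_conj_mul_order_tauStable` (τ-stable family, Q5's restriction-injectivity binder
  `hres` in place of Gross's Prop. 9.1).
Steps C–H (finite exceptional set — here also the bad places of `E/ℚ`, so that `2^M ∣ a_ℓ` can be
read off —, Čebotarev in `c₀ · res(ρ𝒩)`, inertness of `ℓ`, the local criterion (3) at `λ`) are
the tree's, unchanged.

* `exists_kolyvaginPrime_gt_two_tauStable` — for every bound `b` a prime `ℓ > b`, `ℓ ∤ 2 N d_K`,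
  `(ℓ)` prime in `𝓞 K`, with `Frob(ℓ) = Frob(∞)` on `K(E[2^M])` (`FrobEqFrobInfty W K (2^M) ℓ`),
  `2^M ∣ ℓ + 1`, `2^M ∣ a_ℓ` (so `ℓ` is a Kolyvagin prime at `2` in Zhang's sense with
  `M ≤ M(ℓ)`), and `ord c_{i,λ} = 2^{N_i}` exactly for all `i`.
* `equivariantChebotarev_infinite_of_chebotarev_two` — the `Set.Infinite` form with the local
  clause of Q5 (`2^j c_i ∈ ker loc_λ ↔ N_i ≤ j`).

HONEST FRAMING. Conditional on the named fact `Automorphic.chebotarev_artinRep` (as the odd-`p`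
tree theorem) and on `hS`/`hCe`/`hfree₀`/`hπ`; Q5 itself (which quantifies over all imaginary
quadratic `K`) is NOT closed — see the binder caveat. BSD is not proved by any of this.

References: [McCallumLMS1991] §3 Prop. 3.1, Cor. 3.2 (pp. 279–280); [GrossLMS1991] §3 (3.1)–(3.3),
§9; [TateGCFT1967] §2.4; [SilvermanAEC2009] VII.4.1.
-/

set_option autoImplicit false
set_option linter.dupNamespace false

noncomputable section

open scoped Classical Pointwise

namespace Summit.BirchSwinnertonDyer.BirchSwinnertonDyer.Theorems.GenusExact

open WeierstrassCurve NumberField IsDedekindDomain Field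
open Literature.NumberTheory.GaloisRepresentations Literature.NumberTheory.EllipticCurves
open Literature.NumberTheory
open Rat.HeightOneSpectrum

universe u

variable {W : WeierstrassCurve ℚ} {K : Type u} [Field K] [NumberField K]

set_option maxHeartbeats 1600000 in
/-- **One Kolyvagin prime at `2` of level `2^M` above any bound, with prescribed local orders, for
a `τ`-STABLE independent family** (McCallum 1991 Prop. 3.1 / Cor. 3.2 at `p = 2`). Hypotheses:
`K` imaginary quadratic with `c ≠ 1` in `Aut(K/ℚ)` and a complex conjugation `c₀ ∈ Γ_ℚ`; `E = W/ℚ`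
globally minimal; `E(K̄)[2]` a simple `Γ_K`-module with scalar commutant (`hS`, `hCe`);
`P₀ ∈ E(ℚ̄)[2^M]` with `ℤP₀ + ℤc₀P₀` free over `ℤ/2^M` (`hfree₀`); classes
`c_i ∈ H¹(K, E[2^M])` with `c_* c_i = c_{π i}` (`π` an involution), killed by `2^{eᵢ}` (`eᵢ ≤ M`),
independent, with restriction to `Γ_{K(E[2^M])}` injective on their span; `N_i ≤ e_i`,
`N_{π i} = N_i`; the Čebotarev density theorem. Conclusion: for every `b` a prime `ℓ > b` with
`ℓ ∤ N`, `ℓ ∤ d_K`, `ℓ ≠ 2`, `(ℓ)` prime in `𝓞 K`, `FrobEqFrobInfty W K (2^M) ℓ`, `2^M ∣ ℓ + 1`,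
`2^M ∣ a_ℓ`, and at the place `λ ∋ ℓ`: `2^{N_i} c_{i,λ} = 0`, `2^{N_i − 1} c_{i,λ} ≠ 0` (`N_i ≠ 0`).
[cite: McCallumLMS1991, §3 Cor. 3.2 (proof, with Prop. 3.1)] [cite: GrossLMS1991, §3 (3.3)] -/
theorem exists_kolyvaginPrime_gt_two_tauStable (hC : Automorphic.chebotarev_artinRep) {N : ℕ}
    [NeZero N] [W.IsElliptic] [W.IsGloballyMinimal] (hK : IsImaginaryQuadratic K) {M : ℕ}
    (hM : 1 ≤ M)
    (hS : ∀ H : AddSubgroup (geomTorsion (W.baseChange K) 2),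
      (∀ g : absoluteGaloisGroup K, ∀ t ∈ H, g • t ∈ H) → H = ⊥ ∨ H = ⊤)
    (hCe : ∀ f : geomTorsion (W.baseChange K) 2 →+ geomTorsion (W.baseChange K) 2,
      (∀ (g : absoluteGaloisGroup K) (t : geomTorsion (W.baseChange K) 2), f (g • t) = g • f t) →
        ∃ k : ℤ, ∀ t, f t = k • t)
    {c₀ : absoluteGaloisGroup ℚ} (hc₀ : IsComplexConjugation (Rat.castHom ℝ) c₀)
    {P₀ : geomTorsion W ((2 ^ M : ℕ) : ℤ)}
    (hfree₀ : ∀ a b : ℤ, a • P₀ + b • (c₀ • P₀) = 0 → (2 : ℤ) ^ M ∣ a ∧ (2 : ℤ) ^ M ∣ b)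
    {c : K ≃ₐ[ℚ] K} (hc : c ≠ 1) {r : ℕ}
    (cs : Fin r → galH1Torsion (W.baseChange K) ((2 ^ M : ℕ) : ℤ)) {π : Fin r → Fin r}
    (hπ : ∀ i, π (π i) = i) (hτs : ∀ i, conjAct W c ((2 ^ M : ℕ) : ℤ) (cs i) = cs (π i))
    (ex : Fin r → ℕ) (hex : ∀ i, ((2 : ℤ) ^ ex i) • cs i = 0) (hexM : ∀ i, ex i ≤ M)
    (hind : ∀ a : Fin r → ℤ, ∑ i, a i • cs i = 0 → ∀ i, ((2 : ℤ) ^ ex i) ∣ a i)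
    (hres : ∀ a : Fin r → ℤ, (∀ ρ ∈ torsionFixing (W.baseChange K) ((2 ^ M : ℕ) : ℤ),
      h1Eval (W.baseChange K) ((2 ^ M : ℕ) : ℤ) (∑ i, a i • cs i) ρ = 0) → ∑ i, a i • cs i = 0)
    (Nv : Fin r → ℕ) (hNe : ∀ i, Nv i ≤ ex i) (hNπ : ∀ i, Nv (π i) = Nv i) (b : ℕ) :
    ∃ ℓ : ℕ, b < ℓ ∧ ℓ.Prime ∧ ¬ ℓ ∣ N ∧ ¬ ((ℓ : ℤ) ∣ NumberField.discr K) ∧ ℓ ≠ 2 ∧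
      (Ideal.span {(ℓ : 𝓞 K)}).IsPrime ∧ FrobEqFrobInfty W K (2 ^ M) ℓ ∧
      2 ^ M ∣ ℓ + 1 ∧ ((2 : ℤ) ^ M) ∣ W.frobeniusTrace ℓ ∧
      ∀ i, ∀ v : HeightOneSpectrum (𝓞 K), (ℓ : 𝓞 K) ∈ v.asIdeal →
        (((2 : ℤ) ^ Nv i) • cs i ∈
            (W.baseChange K).torsionLocalKer (v.adicCompletion K) ((2 ^ M : ℕ) : ℤ) ∧
          (Nv i ≠ 0 → ((2 : ℤ) ^ (Nv i - 1)) • cs i ∉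
            (W.baseChange K).torsionLocalKer (v.adicCompletion K) ((2 ^ M : ℕ) : ℤ))) := by
  classical
  have hp : Nat.Prime 2 := Nat.prime_two
  haveI : Fact (Nat.Prime 2) := ⟨hp⟩
  haveI : Algebra.IsQuadraticExtension ℚ K := ⟨hK.1⟩
  haveI : IsTotallyComplex K := hK.2
  have hn0 : ((2 ^ M : ℕ) : ℤ) ≠ 0 := by exact_mod_cast pow_ne_zero M hp.ne_zero
  have h2n : (2 : ℤ) ∣ ((2 ^ M : ℕ) : ℤ) := by
    rw [Nat.cast_pow]; exact dvd_pow_self _ (by omega)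
  -- ### Step A: the involutive lift of complex conjugation and the free generator on `E(K̄)[2^M]`
  set t : AlgebraicClosure K ≃+* AlgebraicClosure K :=
    (absGaloisTransport (K := ℚ) (L := K) c₀).toRingEquiv with ht_def
  have ht : IsLiftOfAut c t :=
    RatClosure.isLiftOfAut_absGaloisTransport_of_isImaginaryQuadratic hK hc hc₀
  have hinv : ∀ x, t (t x) = x := fun x ↦
    RatClosure.absGaloisTransport_absGaloisTransport_of_sq_eq_one hc₀.sq_eq_one x
  set θ := RatClosure.torsionEquiv (K := K) W ((2 ^ M : ℕ) : ℤ) with hθ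
  have hθc : ht.torsionMap W ((2 ^ M : ℕ) : ℤ) (θ P₀) = θ (c₀ • P₀) := by
    rw [← RatClosure.torsionEquiv_smul_of_lift W ht c₀ (fun _ ↦ rfl) _ P₀]
  have hPM : (2 : ℤ) ^ M • θ P₀ = 0 := by
    apply Subtype.ext
    rw [AddSubgroupClass.coe_zsmul, ZeroMemClass.coe_zero]
    have := (mem_geomTorsion_iff (W.baseChange K) _ ((θ P₀ : geomTorsion (W.baseChange K) _) :
      geomPoints (W.baseChange K))).mp (θ P₀).2
    exact_mod_cast this
  have hfree : ∀ a b : ℤ, a • θ P₀ + b • ht.torsionMap W ((2 ^ M : ℕ) : ℤ) (θ P₀) = 0 →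
      (2 : ℤ) ^ M ∣ a ∧ (2 : ℤ) ^ M ∣ b := by
    intro a b' hab
    rw [hθc, ← map_zsmul, ← map_zsmul, ← map_add, map_eq_zero_iff _ θ.injective] at hab
    exact hfree₀ a b' hab
  -- ### Step B: the choice of `ρ` (McCallum (2) and Prop. 3.1 at `2`, τ-stable family)
  obtain ⟨ρ, hρT, hρ⟩ := exists_h1Eval_conj_mul_order_tauStable W ht hinv h2n hS hCe hPM hfree hπ
    hτs ex hex hind hres Nv hNe hexM hNπ
  -- ### Step C: the finite exceptional set of places of `ℚ`
  have hbad : ((W.baseChange K).badPlaces (𝓞 K)).Finite :=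
    (W.baseChange K).finite_badPlaces_holds (𝓞 K)
  have hbad₀ : (W.badPlaces (𝓞 ℚ)).Finite := W.finite_badPlaces_holds (𝓞 ℚ)
  choose T hTfin hT using fun i ↦
    exists_finite_forall_mem_unramifiedKer (W.baseChange K) hn0 (cs i)
  set B : Finset ℕ := {2} ∪ N.primeFactors ∪ (NumberField.discr K).natAbs.primeFactors ∪
    Finset.range (b + 1) with hB
  set S₁ : Set (HeightOneSpectrum (𝓞 ℚ)) := {v | ∃ q ∈ B, q.Prime ∧ (q : 𝓞 ℚ) ∈ v.asIdeal}
    with hS₁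
  set S₂ : Set (HeightOneSpectrum (𝓞 ℚ)) := {v | ¬ Algebra.IsUnramifiedIn (𝓞 K) v.asIdeal}
    with hS₂
  set S₃ : Set (HeightOneSpectrum (𝓞 ℚ)) :=
    (fun w : HeightOneSpectrum (𝓞 K) ↦ w.under (𝓞 ℚ)) ''
      ((W.baseChange K).badPlaces (𝓞 K) ∪ ⋃ i, T i) with hS₃
  have hS₁fin : S₁.Finite := by
    have : S₁ ⊆ ⋃ q ∈ (B.filter Nat.Prime), {v | (q : 𝓞 ℚ) ∈ v.asIdeal} := by
      intro v ⟨q, hqB, hq, hqv⟩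
      simp only [Set.mem_iUnion, Finset.mem_filter]
      exact ⟨q, ⟨hqB, hq⟩, hqv⟩
    refine Set.Finite.subset (Set.Finite.biUnion (Finset.finite_toSet _) fun q hq ↦ ?_) this
    rw [Finset.coe_filter, Set.mem_setOf_eq] at hq
    have hsub : {v : HeightOneSpectrum (𝓞 ℚ) | (q : 𝓞 ℚ) ∈ v.asIdeal}.Subsingleton :=
      fun v hv v' hv' ↦ HeightOneSpectrum.eq_of_natCast_mem_rat hq.2 hv hv'
    exact hsub.finite
  have hS₂fin : S₂.Finite := finite_setOf_not_isUnramifiedIn ℚ K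
  have hS₃fin : S₃.Finite :=
    (hbad.union (Set.finite_iUnion fun i ↦ hTfin i)).image _
  set S := S₁ ∪ S₂ ∪ S₃ ∪ W.badPlaces (𝓞 ℚ) with hSdef
  have hSfin : S.Finite := ((hS₁fin.union hS₂fin).union hS₃fin).union hbad₀
  -- ### Step D: Čebotarev in `Γ_ℚ`: a Frobenius in the open set `c₀ · res(ρ 𝒩)`
  set 𝒩 := evalKer (W.baseChange K) ((2 ^ M : ℕ) : ℤ) cs with h𝒩
  have h𝒩open : IsOpen (𝒩 : Set (absoluteGaloisGroup K)) :=
    isOpen_evalKer (W.baseChange K) _ cs (isOpen_torsionFixing (W.baseChange K) hn0)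
  set O : Set (absoluteGaloisGroup ℚ) :=
    (fun γ ↦ c₀ * γ) '' (absGaloisRestrict ℚ K '' ((fun m ↦ ρ * m) '' (𝒩 : Set _))) with hO
  have hOopen : IsOpen O := by
    refine (Homeomorph.mulLeft c₀).isOpenMap _ (isOpenMap_absGaloisRestrict K _ ?_)
    exact (Homeomorph.mulLeft ρ).isOpenMap _ h𝒩open
  have hOne : O.Nonempty :=
    ⟨c₀ * absGaloisRestrict ℚ K (ρ * 1), _, ⟨_, ⟨1, 𝒩.one_mem, rfl⟩, rfl⟩, rfl⟩
  obtain ⟨γ, hγO, v, hvS, 𝔓₀, h𝔓₀, hγ⟩ :=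
    (absoluteGaloisGroup.frobenius_dense hC ℚ S hSfin).inter_open_nonempty O hOopen hOne
  obtain ⟨_, ⟨_, ⟨m, hm, rfl⟩, rfl⟩, rfl⟩ := hγO
  set g := ρ * m with hg
  have hgT : g ∈ torsionFixing (W.baseChange K) ((2 ^ M : ℕ) : ℤ) := mul_mem hρT hm.1
  -- ### Step E: the rational prime `ℓ` under `v`
  obtain ⟨ℓ, hℓ, hℓv⟩ := exists_prime_natCast_mem v
  have hℓB : ℓ ∉ B := fun h ↦ hvS (Or.inl (Or.inl (Or.inl ⟨ℓ, h, hℓ, hℓv⟩)))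
  simp only [hB, Finset.mem_union, Finset.mem_singleton, Nat.mem_primeFactors,
    Finset.mem_range, not_or] at hℓB
  obtain ⟨⟨⟨hℓp, hℓN⟩, hℓD⟩, hℓb⟩ := hℓB
  have hℓN' : ¬ ℓ ∣ N := fun h ↦ hℓN ⟨hℓ, h, NeZero.ne N⟩
  have hℓD' : ¬ ((ℓ : ℤ) ∣ NumberField.discr K) := fun h ↦
    hℓD ⟨hℓ, Int.natAbs_dvd_natAbs.mpr h |>.trans (by simp), by
      simp [NumberField.discr_ne_zero]⟩
  have hbℓ : b < ℓ := by omega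
  have hunr : Algebra.IsUnramifiedIn (𝓞 K) v.asIdeal := by
    by_contra h; exact hvS (Or.inl (Or.inl (Or.inr h)))
  have hvS₃ : v ∉ S₃ := fun h ↦ hvS (Or.inl (Or.inr h))
  have hgood₀ : W.HasGoodReductionAt v := by
    by_contra h; exact hvS (Or.inr h)
  -- ### Step F: `ℓ` is inert, with a Frobenius `τ' = g^τ g` over `K`
  have hHi := index_range_absGaloisRestrict_eq_finrank ℚ K
  haveI hHn : ((absGaloisRestrict ℚ K).range).Normal :=
    Subgroup.normal_of_index_eq_two (hHi.trans hK.1)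
  have hI := inertia_le_range_absGaloisRestrict_of_isUnramifiedIn (K := K) hunr h𝔓₀
  have hΦH : c₀ * absGaloisRestrict ℚ K g ∉ (absGaloisRestrict ℚ K).range := by
    intro h
    apply hc₀.not_mem_range_absGaloisRestrict (L := K) IsTotallyComplex.isComplex
    change c₀ ∈ ((absGaloisRestrict ℚ K).range : Set (absoluteGaloisGroup ℚ))
    have h' : c₀ = c₀ * absGaloisRestrict ℚ K g * (absGaloisRestrict ℚ K g)⁻¹ := by group
    rw [SetLike.mem_coe, h']
    exact Subgroup.mul_mem _ h (Subgroup.inv_mem _ ⟨g, rfl⟩)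
  obtain ⟨w, 𝔔, τ', hwv, hwuniq, -, h𝔔w, -, hτ', hresτ'⟩ :=
    exists_place_inert_of_not_mem_range (F := ℚ) (M := K) (hK.1 ▸ Nat.prime_two) hHn
      (hHi.trans rfl) hunr h𝔓₀ hI hγ hΦH
  rw [hK.1, sq_eq_absGaloisRestrict_conjGal_mul hc₀ ht g] at hresτ'
  have hτ'eq : τ' = ht.conjGalCMH g * g := absGaloisRestrict_injective ℚ K hresτ'
  -- `ℓ ∈ w`, and `w` is the only place of `K` containing `ℓ`
  have hℓw : (ℓ : 𝓞 K) ∈ w.asIdeal := by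
    have h1 : (ℓ : 𝓞 ℚ) ∈ (w.under (𝓞 ℚ)).asIdeal := by rw [hwv]; exact hℓv
    rw [HeightOneSpectrum.under_asIdeal, Ideal.under_def, Ideal.mem_comap, map_natCast] at h1
    exact h1
  have hwuniq' : ∀ w' : HeightOneSpectrum (𝓞 K), (ℓ : 𝓞 K) ∈ w'.asIdeal → w' = w := by
    intro w' hw'
    apply hwuniq
    apply HeightOneSpectrum.eq_of_natCast_mem_rat hℓ _ hℓv
    rw [HeightOneSpectrum.under_asIdeal, Ideal.under_def, Ideal.mem_comap, map_natCast]
    exact hw'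
  -- `(ℓ) = w` is prime
  have hspan : Ideal.span {(ℓ : 𝓞 K)} = w.asIdeal := by
    apply span_natCast_eq_of_unique hℓ w hwuniq'
    haveI : w.asIdeal.LiesOver v.asIdeal := ⟨by rw [← hwv]; rfl⟩
    have hmap : v.asIdeal.map (algebraMap (𝓞 ℚ) (𝓞 K)) = Ideal.span {(ℓ : 𝓞 K)} := by
      rw [← span_natCast_rat_eq hℓ hℓv, Ideal.map_span, Set.image_singleton, map_natCast]
    have hne : v.asIdeal.map (algebraMap (𝓞 ℚ) (𝓞 K)) ≠ ⊥ := by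
      rw [hmap, Ne, Ideal.span_singleton_eq_bot]; exact_mod_cast hℓ.ne_zero
    rw [← hmap, ← Ideal.IsDedekindDomain.ramificationIdx_eq_normalizedFactors_count v.asIdeal
      w.asIdeal hne]
    exact Ideal.ramificationIdx_eq_one_iff.mpr (hunr w.asIdeal w.isPrime inferInstance)
  -- ### Step G: the local criterion at `w`, for the classes `2^a c_i`
  have hloc : ∀ i (a : ℕ), (((2 : ℤ) ^ a) • cs i ∈
      (W.baseChange K).torsionLocalKer (w.adicCompletion K) ((2 ^ M : ℕ) : ℤ) ↔
        ((2 : ℤ) ^ a) • h1Eval (W.baseChange K) ((2 ^ M : ℕ) : ℤ) (cs i)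
          (ht.conjGalCMH (ρ * m) * (ρ * m)) = 0) := by
    intro i a
    haveI : CharZero (w.adicCompletion K) :=
      charZero_of_injective_algebraMap (algebraMap K (w.adicCompletion K)).injective
    obtain ⟨𝔐, h𝔐⟩ := w.localPrimesAbove_nonempty
    set 𝔓w := w.primeBelow (closureEmb (K := K) (w.adicCompletion K)) 𝔐 with h𝔓w_def
    have h𝔓w : 𝔓w ∈ w.primesAbove := w.primeBelow_mem_primesAbove h𝔐
    obtain ⟨δ, hδ, hF⟩ :=
      HeightOneSpectrum.exists_isArithFrobAt_conj_of_mem_primesAbove_holds h𝔔w h𝔓w hτ'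
    have hτ'T : τ' ∈ torsionFixing (W.baseChange K) ((2 ^ M : ℕ) : ℤ) := by
      rw [hτ'eq]; exact mul_mem (ht.conjGalCMH_mem_torsionFixing W hinv _ hgT) hgT
    have hFT : δ * τ' * δ⁻¹ ∈ torsionFixing (W.baseChange K) ((2 ^ M : ℕ) : ℤ) :=
      (torsionFixing_normal (W.baseChange K) _).conj_mem _ hτ'T δ
    have hwbad : w ∉ (W.baseChange K).badPlaces (𝓞 K) := fun h ↦
      hvS₃ ⟨w, Or.inl h, hwv⟩
    have hwT : w ∉ T i := fun h ↦ hvS₃ ⟨w, Or.inr (Set.mem_iUnion.mpr ⟨i, h⟩), hwv⟩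
    have hpw : (((2 : ℕ) : ℤ) : 𝓞 K) ∉ w.asIdeal := by
      rw [Int.cast_natCast]
      exact not_natCast_mem_of_prime_ne hℓ hp hℓp w hℓw
    have hpMw : ((((2 ^ M : ℕ) : ℤ)) : 𝓞 K) ∉ w.asIdeal := fun h ↦ by
      apply hpw
      rw [Int.cast_natCast, Nat.cast_pow] at h
      rw [Int.cast_natCast]
      exact w.isPrime.mem_of_pow_mem M h
    have hcrit := mem_torsionLocalKer_iff_h1Eval_eq_zero (W.baseChange K) ((2 ^ M : ℕ) : ℤ) h𝔐
      hF hFT (inertia_le_torsionFixing (W.baseChange K) hwbad hpMw _ h𝔐)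
      (isOpen_torsionFixing (W.baseChange K) hn0)
      (torsionPointsMap_bijective (W.baseChange K) (w.adicCompletion K)
        (pow_ne_zero M hp.ne_zero)).2
      (AddSubgroup.zsmul_mem _ (hT i w hwT 𝔓w h𝔓w) ((2 : ℤ) ^ a))
    rw [hcrit, h1Eval_conj (W.baseChange K) _ _ δ hτ'T, smul_eq_zero_iff_eq,
      h1Eval_zsmul (W.baseChange K) _ _ _ hτ'T, hτ'eq]
  -- ### Step H: assemble; (3.2) ⟹ (3.3) at `2^M`
  have h32 : FrobEqFrobInfty W K (2 ^ M) ℓ := by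
    refine ⟨v, 𝔓₀, c₀ * absGaloisRestrict ℚ K g, c₀, hℓv, h𝔓₀, hγ, hc₀, fun P ↦ ?_, fun e x ↦ ?_⟩
    · rw [mul_smul, absGaloisRestrict_smul_eq_of_mem_torsionFixing W hgT]
    · rw [mul_smul, absGaloisRestrict_smul_apply_eq g e x]
  have hℓ2 : ℓ ≠ 2 := hℓp
  have hdvd1 : 2 ^ M ∣ ℓ + 1 := pow_dvd_add_one_of_frobEqFrobInfty W (K := K) hp hM hℓ hℓ2 h32
  have hdvd2 : ((2 : ℤ) ^ M) ∣ W.frobeniusTrace ℓ := by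
    have h := pow_dvd_frobeniusTraceAt_of_frobEqFrobInfty W (K := K) hp hM hℓ hℓ2 h32 hℓv hgood₀
    rw [frobeniusTraceAt_eq_frobeniusTrace W v] at h
    rwa [show ((primesEquiv v : ℕ)) = ℓ from primesEquiv_eq_of_natCast_mem hℓ hℓv] at h
  refine ⟨ℓ, hbℓ, hℓ, hℓN', hℓD', hℓ2, hspan ▸ w.isPrime, h32, hdvd1, hdvd2, fun i v' hv' ↦ ?_⟩
  rw [hwuniq' v' hv']
  exact ⟨(hloc i (Nv i)).mpr (hρ m hm i).1, fun hN h ↦ (hρ m hm i).2 hN ((hloc i _).mp h)⟩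

/-- **The `Set.Infinite` form with Q5's local clause.** Under the hypotheses of
`exists_kolyvaginPrime_gt_two_tauStable`: infinitely many primes `ℓ` with `Frob(ℓ) = Frob(∞)` on
`K(E[2^M])`, `ℓ` a Kolyvagin prime at `2` in Zhang's sense with `M ≤ M(ℓ)`, and, at the place
`λ ∋ ℓ`, `2^j c_{i,λ} = 0 ↔ N_i ≤ j` for every `i`, `j` — the conclusion of Q5
`EquivariantChebotarevAtTwo` VERBATIM, for the given family. [cite: McCallumLMS1991, §3 Cor. 3.2]
[cite: WZhang2014, Notations (xii)] -/
theorem setInfinite_kolyvaginPrime_two_tauStable (hC : Automorphic.chebotarev_artinRep) {N : ℕ}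
    [NeZero N] [W.IsElliptic] [W.IsGloballyMinimal] (hK : IsImaginaryQuadratic K) {M : ℕ}
    (hM : 1 ≤ M)
    (hS : ∀ H : AddSubgroup (geomTorsion (W.baseChange K) 2),
      (∀ g : absoluteGaloisGroup K, ∀ t ∈ H, g • t ∈ H) → H = ⊥ ∨ H = ⊤)
    (hCe : ∀ f : geomTorsion (W.baseChange K) 2 →+ geomTorsion (W.baseChange K) 2,
      (∀ (g : absoluteGaloisGroup K) (t : geomTorsion (W.baseChange K) 2), f (g • t) = g • f t) →
        ∃ k : ℤ, ∀ t, f t = k • t)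
    {c₀ : absoluteGaloisGroup ℚ} (hc₀ : IsComplexConjugation (Rat.castHom ℝ) c₀)
    {P₀ : geomTorsion W ((2 ^ M : ℕ) : ℤ)}
    (hfree₀ : ∀ a b : ℤ, a • P₀ + b • (c₀ • P₀) = 0 → (2 : ℤ) ^ M ∣ a ∧ (2 : ℤ) ^ M ∣ b)
    {c : K ≃ₐ[ℚ] K} (hc : c ≠ 1) {r : ℕ}
    (cs : Fin r → galH1Torsion (W.baseChange K) ((2 ^ M : ℕ) : ℤ)) {π : Fin r → Fin r}
    (hπ : ∀ i, π (π i) = i) (hτs : ∀ i, conjAct W c ((2 ^ M : ℕ) : ℤ) (cs i) = cs (π i))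
    (ex : Fin r → ℕ) (hex : ∀ i, ((2 : ℤ) ^ ex i) • cs i = 0) (hexM : ∀ i, ex i ≤ M)
    (hind : ∀ a : Fin r → ℤ, ∑ i, a i • cs i = 0 → ∀ i, ((2 : ℤ) ^ ex i) ∣ a i)
    (hres : ∀ a : Fin r → ℤ, (∀ ρ ∈ torsionFixing (W.baseChange K) ((2 ^ M : ℕ) : ℤ),
      h1Eval (W.baseChange K) ((2 ^ M : ℕ) : ℤ) (∑ i, a i • cs i) ρ = 0) → ∑ i, a i • cs i = 0)
    (Nv : Fin r → ℕ) (hNe : ∀ i, Nv i ≤ ex i) (hNπ : ∀ i, Nv (π i) = Nv i) :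
    Set.Infinite {ℓ : ℕ | FrobEqFrobInfty W K (2 ^ M) ℓ ∧ Zhang2014.IsKolyvaginPrime N W K 2 ℓ ∧
      M ≤ Zhang2014.kolyvaginIndex W 2 ℓ ∧
      ∀ i, ∀ v : HeightOneSpectrum (𝓞 K), (ℓ : 𝓞 K) ∈ v.asIdeal → ∀ j : ℕ,
        ((2 ^ j : ℕ) : ℤ) • cs i ∈
            (W.baseChange K).torsionLocalKer (v.adicCompletion K) ((2 ^ M : ℕ) : ℤ) ↔ Nv i ≤ j} := by
  haveI : Fact (Nat.Prime 2) := ⟨Nat.prime_two⟩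
  refine Set.infinite_of_forall_exists_gt fun b ↦ ?_
  obtain ⟨ℓ, hbℓ, hℓ, hℓN, hℓD, hℓ2, hprime, h32, hdvd1, hdvd2, hloc⟩ :=
    exists_kolyvaginPrime_gt_two_tauStable (N := N) hC hK hM hS hCe hc₀ hfree₀ hc cs hπ hτs ex hex
      hexM hind hres Nv hNe hNπ b
  have hidx : M ≤ Zhang2014.kolyvaginIndex W 2 ℓ :=
    Zhang2014.le_kolyvaginIndex_iff.mpr ⟨hdvd1, hdvd2⟩
  refine ⟨ℓ, ⟨h32, ⟨hℓ, hℓN, hℓD, hℓ2, hprime, lt_of_lt_of_le (by omega) hidx⟩, hidx,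
    fun i v hv j ↦ ?_⟩, hbℓ⟩
  obtain ⟨hA, hB⟩ := hloc i v hv
  have h2j : ((2 ^ j : ℕ) : ℤ) • cs i = ((2 : ℤ) ^ j) • cs i :=
    congrArg (fun z : ℤ ↦ z • cs i) (by push_cast; rfl)
  rw [h2j]
  constructor
  · intro hj
    by_contra hlt
    have hlt' : j < Nv i := Nat.lt_of_not_le hlt
    apply hB (by omega)
    have : ((2 : ℤ) ^ (Nv i - 1)) • cs i = ((2 : ℤ) ^ (Nv i - 1 - j)) • (((2 : ℤ) ^ j) • cs i) := by
      rw [smul_smul, ← pow_add, Nat.sub_add_cancel (by omega)]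
    rw [this]
    exact AddSubgroup.zsmul_mem _ hj _
  · intro hj
    have : ((2 : ℤ) ^ j) • cs i = ((2 : ℤ) ^ (j - Nv i)) • (((2 : ℤ) ^ Nv i) • cs i) := by
      rw [smul_smul, ← pow_add, Nat.sub_add_cancel hj]
    rw [this]
    exact AddSubgroup.zsmul_mem _ hA _

end Summit.BirchSwinnertonDyer.BirchSwinnertonDyer.Theorems.GenusExact

end
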